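import Literature.NumberTheory.Automorphic.UnitaryCurveCohCotangentForms
import Literature.NumberTheory.Automorphic.UnitaryGroupIsotropicLineElements
import Literature.NumberTheory.Automorphic.UnitaryGroupLevelTransport
import HarnessLib

noncomputable section
/-!
# Crux `HLiu418`, line `F0_AlbCm`, stub `stub_S1_betti` (n = 2 slice) — the two Hodge types of CURVE cotangent forms are DISJOINT and
# Hecke-stable (the `n = 2` twin of programme P3's stub S2 `StubS2HodgeTypesDisjointStable`, ★ `Theorems/F0P3StubS2HodgeTypes.lean`)

Floor-0 programme P5 (Alb-CM), seat F0P5-p03 (g0); crux item stmt-HodgeConjecture-24832 (`HCCMUnconditional.HLiu418`).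
HC_CM is proved only modulo the 7 printed citations until rung 0 closes; this file is letter-free and `sorry`-free.

Over A-p01 (g12)'s carriers `UnitaryCurveForms.{holCotForms₂, conjFun₂, rightRep₂, ConeFrame}` (the `(1,0)` cotangent automorphic forms
of the unitary Shimura CURVES of `U(J)`, `J ∈ M₂(E)`, in cone coordinates at the complex place `w₁`):
* `exists_archLocal_fix_smul` — for a cone frame `𝔣 = (v₀, t₀)` of a HERMITIAN `σ_{w₁}J` there is `b ∈ U(σ_{w₁}J)(ℂ)` with `b v₀ = v₀`,
  `b t₀ = I • t₀` (the element `π + I (1 − π)`, `π` the `σ_{w₁}J`-orthogonal projection onto `ℂ v₀`); its cotangent character is `I ∉ ℝ`;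
* `disjoint_holCotForms₂_map_conjFun₂` — `holCotForms₂ 𝔣 ⊓ conj (holCotForms₂ 𝔣) = ⊥`: a form that is both holomorphic-cotangent and the
  conjugate of one has `w₁`-slices `Φ` with `Φ(u b) = I Φ(u)` AND `Φ(u b) = conj(I) Φ(u)`, so `Φ = 0` on `U(σ_{w₁}J)(ℂ)` and the form vanishes
  ([Borel1997, §5.14]: a function of `K_∞`-type `m ≠ 0` and of type `−m` is zero; [BorelWallach2000, VII 2.10]);
* `rightRep₂_mem_map_conjFun₂`, `hodgeTypes₂_disjoint_stable` — Hecke-stability of both types (M2's `rightRep₂_mem_holCotForms₂`,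
  `conjFun₂_rightRep₂`) packaged in the shape of hypothesis `hS2` of the slice's assembly lemma `rank_intertwiningMap_le_one_of_split`.

References: [Borel1997] A. Borel, *Automorphic forms on SL₂(ℝ)*, §5.13–§5.14; [BorelWallach2000] VII 2.10, 3.2; [Liu2021] App. D l. 5357–5359.
-/

namespace Summit.HodgeConjecture.HodgeConjecture.Cruxes.HLiu418.CurveHodgeTypesDisjoint

-- the mandated namespace repeats `HodgeConjecture.HodgeConjecture`, as in every `Theorems/*.lean` of this sub-problem
set_option linter.dupNamespace false

open NumberField NumberField.InfinitePlace Matrix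
open scoped Matrix MatrixGroups ComplexConjugate ComplexOrder
open Literature.NumberTheory.Automorphic Literature.NumberTheory.Automorphic.UnitaryGroup
open Literature.NumberTheory.Automorphic.UnitaryCurveForms
open Literature.AlgebraicGeometry.ShimuraVarieties

/-! ## §1 A stabiliser element of the cone frame with non-real cotangent character -/

section Frame

variable {E : Type} [Field E] [NumberField E] {J : Matrix (Fin 2) (Fin 2) E} {w₁ : {w : InfinitePlace E // IsComplex w}}

/-- `(u ⊗ r) x = (r ⬝ x) u` for the rank-one matrix `vecMulVec u r` over `ℂ`. [folklore] -/
theorem vecMulVec_mulVec_eq_smul (u r x : Fin 2 → ℂ) : vecMulVec u r *ᵥ x = (r ⬝ᵥ x) • u := by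
  rw [Matrix.vecMulVec_mulVec, op_smul_eq_smul]

/-- Hermitian symmetry of the form `⟪u, v⟫ = star u ⬝ᵥ (H v)`: `conj ⟪u, v⟫ = ⟪v, u⟫`. [folklore] -/
theorem star_dotProduct_mulVec_comm {H : Matrix (Fin 2) (Fin 2) ℂ} (hH : H.IsHermitian) (u v : Fin 2 → ℂ) :
    starRingEnd ℂ (star u ⬝ᵥ (H *ᵥ v)) = star v ⬝ᵥ (H *ᵥ u) := by
  rw [← Complex.star_def, star_dotProduct, star_star, star_mulVec, ← dotProduct_mulVec, hH.eq]

omit [NumberField E] in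
/-- **The element `b = I·1 + (1 − I)·π` of `U(σ_{w₁}J)(ℂ)` fixing `v₀` and rotating `t₀` by `I`.**  For a cone frame `𝔣 = (v₀, t₀)`
(`v₀` negative, `t₀` positive and `σ_{w₁}J`-orthogonal to `v₀`) of a HERMITIAN `σ_{w₁}J`, with `π x = (⟪v₀, x⟫ ∕ ⟪v₀, v₀⟫) v₀` the
orthogonal projection onto `ℂ v₀`: `b v₀ = v₀`, `b t₀ = I t₀`, and `b` preserves the form (it is diagonal with unimodular entries `(1, I)` in the
orthogonal basis `(v₀, t₀)`), i.e. `b ∈ archLocal E 2 J w₁ = U(σ_{w₁}J)(ℂ) ∩ Stab(ℂ v₀) ≅ U(1) × U(1)` with cotangent character `χ_cot(b) = I`.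
[cite: Borel1997, §5.13] [cite: BergeronMillsonMoeglin2016Balls, Part 2 §1.3] -/
theorem exists_archLocal_fix_smul (hJ : (J.map w₁.1.embedding).IsHermitian) (𝔣 : ConeFrame E J w₁) :
    ∃ b : archLocal E 2 J w₁,
      ((b : GL (Fin 2) ℂ) : Matrix (Fin 2) (Fin 2) ℂ) *ᵥ 𝔣.v₀ = 𝔣.v₀ ∧
        ((b : GL (Fin 2) ℂ) : Matrix (Fin 2) (Fin 2) ℂ) *ᵥ 𝔣.t₀ = Complex.I • 𝔣.t₀ := by
  -- notation: `H = σ_{w₁}J`, `q = ⟪v₀, v₀⟫ < 0`, the row `r = q⁻¹ ⟪v₀, ·⟫`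
  set H : Matrix (Fin 2) (Fin 2) ℂ := J.map w₁.1.embedding with hHdef
  set q : ℂ := star 𝔣.v₀ ⬝ᵥ (H *ᵥ 𝔣.v₀) with hqdef
  have hqre : q.re < 0 := mem_negCone_iff.1 𝔣.v₀_mem
  have hq0 : q ≠ 0 := fun h => by rw [h, Complex.zero_re] at hqre; exact lt_irrefl _ hqre
  have hqreal : starRingEnd ℂ q = q := star_dotProduct_mulVec_comm hJ _ _
  let r : Fin 2 → ℂ := q⁻¹ • star (H *ᵥ 𝔣.v₀)
  have hr : ∀ x : Fin 2 → ℂ, r ⬝ᵥ x = q⁻¹ * (star 𝔣.v₀ ⬝ᵥ (H *ᵥ x)) := fun x => by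
    show (q⁻¹ • star (H *ᵥ 𝔣.v₀)) ⬝ᵥ x = _
    rw [smul_dotProduct, smul_eq_mul, star_mulVec, ← dotProduct_mulVec, hJ.eq]
  have hrv : r ⬝ᵥ 𝔣.v₀ = 1 := by rw [hr, ← hqdef, inv_mul_cancel₀ hq0]
  have hrt : r ⬝ᵥ 𝔣.t₀ = 0 := by
    rw [hr, ← star_dotProduct_mulVec_comm hJ 𝔣.t₀ 𝔣.v₀]
    have h0 : star 𝔣.t₀ ⬝ᵥ (H *ᵥ 𝔣.v₀) = 0 := 𝔣.orth
    rw [h0, map_zero, mul_zero]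
  -- the matrices `b = I + (1 − I) π` and `b⁻¹ = −I + (1 + I) π`, `π = v₀ ⊗ r`
  let P : Matrix (Fin 2) (Fin 2) ℂ := vecMulVec 𝔣.v₀ r
  have hPP : P * P = P := by
    show vecMulVec 𝔣.v₀ r * vecMulVec 𝔣.v₀ r = vecMulVec 𝔣.v₀ r
    rw [vecMulVec_mul_vecMulVec, hrv, one_smul]
  let Bm : Matrix (Fin 2) (Fin 2) ℂ := Complex.I • (1 : Matrix (Fin 2) (Fin 2) ℂ) + (1 - Complex.I) • P
  let Bi : Matrix (Fin 2) (Fin 2) ℂ := (-Complex.I) • (1 : Matrix (Fin 2) (Fin 2) ℂ) + (1 + Complex.I) • P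
  have hmul : ∀ a b a' b' : ℂ, (a • (1 : Matrix (Fin 2) (Fin 2) ℂ) + b • P) * (a' • (1 : Matrix (Fin 2) (Fin 2) ℂ) + b' • P) =
      (a * a') • (1 : Matrix (Fin 2) (Fin 2) ℂ) + (a * b' + b * a' + b * b') • P := by
    intro a b a' b'
    simp only [add_mul, mul_add, smul_mul_smul_comm, one_mul, mul_one, hPP, add_smul]
    abel
  have hBB : Bm * Bi = 1 := by
    show (Complex.I • (1 : Matrix (Fin 2) (Fin 2) ℂ) + (1 - Complex.I) • P) * ((-Complex.I) • 1 + (1 + Complex.I) • P) = 1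
    rw [hmul]
    have h1 : Complex.I * -Complex.I = 1 := by rw [mul_neg, Complex.I_mul_I, neg_neg]
    have h2 : Complex.I * (1 + Complex.I) + (1 - Complex.I) * -Complex.I + (1 - Complex.I) * (1 + Complex.I) = 0 := by
      ring_nf; rw [Complex.I_sq]; ring
    rw [h1, h2, one_smul, zero_smul, add_zero]
  have hBB' : Bi * Bm = 1 := by
    show ((-Complex.I) • (1 : Matrix (Fin 2) (Fin 2) ℂ) + (1 + Complex.I) • P) * (Complex.I • 1 + (1 - Complex.I) • P) = 1
    rw [hmul]
    have h1 : -Complex.I * Complex.I = 1 := by rw [neg_mul, Complex.I_mul_I, neg_neg]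
    have h2 : -Complex.I * (1 - Complex.I) + (1 + Complex.I) * Complex.I + (1 + Complex.I) * (1 - Complex.I) = 0 := by
      ring_nf; rw [Complex.I_sq]; ring
    rw [h1, h2, one_smul, zero_smul, add_zero]
  let Bu : GL (Fin 2) ℂ := ⟨Bm, Bi, hBB, hBB'⟩
  -- `b x = I x + ((1 − I) (r ⬝ x)) v₀`
  have hBx : ∀ x : Fin 2 → ℂ, Bm *ᵥ x = Complex.I • x + ((1 - Complex.I) * (r ⬝ᵥ x)) • 𝔣.v₀ := fun x => by
    show (Complex.I • (1 : Matrix (Fin 2) (Fin 2) ℂ) + (1 - Complex.I) • P) *ᵥ x = _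
    rw [add_mulVec, smul_mulVec, smul_mulVec, one_mulVec, vecMulVec_mulVec_eq_smul, smul_smul]
  have hBv : Bm *ᵥ 𝔣.v₀ = 𝔣.v₀ := by
    rw [hBx, hrv, mul_one, ← add_smul, add_sub_cancel, one_smul]
  have hBt : Bm *ᵥ 𝔣.t₀ = Complex.I • 𝔣.t₀ := by
    rw [hBx, hrt, mul_zero, zero_smul, add_zero]
  -- `b` preserves the hermitian form
  have hmem : Bu ∈ archLocal E 2 J w₁ := by
    rw [archLocal, mem_unitaryGroupOfForm_iff_hermForm]
    intro v w
    show star (Bm *ᵥ v) ⬝ᵥ (H *ᵥ (Bm *ᵥ w)) = star v ⬝ᵥ (H *ᵥ w)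
    rw [hBx, hBx, hr, hr]
    -- expand by sesquilinearity
    simp only [star_add, star_smul, mulVec_add, mulVec_smul, add_dotProduct, dotProduct_add, smul_dotProduct, dotProduct_smul,
      smul_eq_mul, star_mul', Complex.star_def, map_sub, map_one, Complex.conj_I, map_inv₀, hqreal]
    have hvw : starRingEnd ℂ (star 𝔣.v₀ ⬝ᵥ (H *ᵥ v)) = star v ⬝ᵥ (H *ᵥ 𝔣.v₀) := star_dotProduct_mulVec_comm hJ _ _
    rw [hvw, ← hqdef]
    field_simp
    ring_nf
    rw [Complex.I_sq]
    ring
  exact ⟨⟨Bu, hmem⟩, hBv, hBt⟩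

end Frame

/-! ## §2 Disjointness of the two Hodge types and Hecke stability -/

section Carriers

variable (F E : Type) [Field F] [NumberField F] [Field E] [NumberField E] [Algebra F E]
  (c : E ≃ₐ[F] E) (J : Matrix (Fin 2) (Fin 2) E)
  (hc : c ≠ 1) (hfix : ∀ w : InfinitePlace E, c • w = w) (w₁ : {w : InfinitePlace E // IsComplex w})

/-- **`holCotForms₂ 𝔣 ⊓ conj (holCotForms₂ 𝔣) = ⊥` — the `(1,0)` and `(0,1)` curve cotangent forms are DISJOINT** (for `σ_{w₁}J` hermitian).
If `f` is a holomorphic cotangent form and also the conjugate of one, `f′`, then at every adelic point `x` the `w₁`-slices `Φ`, `Φ′` of `f`, `f′`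
satisfy the cotangent law with character `b ↦ a k⁻¹`; at the element `b` of `exists_archLocal_fix_smul` (`k = 1`, `a = I`) this gives
`Φ(b) = I Φ(1)` and `Φ(b) = conj (Φ′(b)) = conj (I Φ′(1)) = −I Φ(1)`, so `Φ(1) = f(x) = 0`. [cite: Borel1997, §5.14] [cite: BorelWallach2000, VII 2.10] -/
theorem disjoint_holCotForms₂_map_conjFun₂ (hJ : (J.map w₁.1.embedding).IsHermitian) (𝔣 : ConeFrame E J w₁) :
    Disjoint (holCotForms₂ F E c J hc hfix w₁ 𝔣) ((holCotForms₂ F E c J hc hfix w₁ 𝔣).map (conjFun₂ F E c J)) := by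
  rw [Submodule.disjoint_def]
  intro f hf hf'
  obtain ⟨f₀, hf₀, rfl⟩ := Submodule.mem_map.1 hf'
  obtain ⟨b, hbv, hbt⟩ := exists_archLocal_fix_smul hJ 𝔣
  funext x
  -- the `w₁`-slices of `conj f₀` and of `f₀` through `x`
  obtain ⟨Φ, hΦ, hΦf⟩ := ((mem_holCotForms₂_iff F E c J hc hfix w₁ 𝔣 _).1 hf).2.2.2 x
  obtain ⟨Φ₀, hΦ₀, hΦ₀f⟩ := ((mem_holCotForms₂_iff F E c J hc hfix w₁ 𝔣 _).1 hf₀).2.2.2 x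
  have h1 : (((1 : archLocal E 2 J w₁) : GL (Fin 2) ℂ) : Matrix (Fin 2) (Fin 2) ℂ) = 1 := by simp
  have hv₀ : (1 : Matrix (Fin 2) (Fin 2) ℂ) *ᵥ 𝔣.v₀ ∈ negCone (J.map w₁.1.embedding) := by
    rw [one_mulVec]; exact 𝔣.v₀_mem
  have hbv' : ((b : GL (Fin 2) ℂ) : Matrix (Fin 2) (Fin 2) ℂ) *ᵥ 𝔣.v₀ = (1 : ℂ) • 𝔣.v₀ := by rw [one_smul]; exact hbv
  have hbt' : ((b : GL (Fin 2) ℂ) : Matrix (Fin 2) (Fin 2) ℂ) *ᵥ 𝔣.t₀ = Complex.I • 𝔣.t₀ + (0 : ℂ) • 𝔣.v₀ := by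
    rw [zero_smul, add_zero]; exact hbt
  -- the cotangent law at `(g, b) = (1, b)`: `Φ(b) = I Φ(1)`, `Φ₀(b) = I Φ₀(1)`
  have hlaw := hΦ.2 1 _ Complex.I 1 0 isUnit_one hv₀ one_ne_zero hbv' hbt'
  have hlaw₀ := hΦ₀.2 1 _ Complex.I 1 0 isUnit_one hv₀ one_ne_zero hbv' hbt'
  rw [one_mul, inv_one, mul_one] at hlaw hlaw₀
  -- the slices read on `f = conj f₀` and `f₀`
  -- (robust to the slice chirality of clause (H): `f (adelicSingle u * x)` in M2 ed. 1, `f (x * adelicSingle u)` in ed. 2)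
  have hΦ1 : Φ 1 = star (f₀ x) := by
    have := hΦf 1
    rw [h1, map_one, mul_one] at this
    exact this
  have hΦ₀1 : Φ₀ 1 = f₀ x := by
    have := hΦ₀f 1
    rw [h1, map_one, mul_one] at this
    exact this
  have hΦb : Φ ((b : GL (Fin 2) ℂ) : Matrix (Fin 2) (Fin 2) ℂ) = star (Φ₀ ((b : GL (Fin 2) ℂ) : Matrix (Fin 2) (Fin 2) ℂ)) := by
    rw [hΦf b, hΦ₀f b]; rfl
  -- `I · conj (f₀ x) = conj (I · f₀ x) = −I · conj (f₀ x)`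
  rw [hlaw, hlaw₀, hΦ1, hΦ₀1, star_mul', Complex.star_def, Complex.conj_I] at hΦb
  have h2 : (2 * Complex.I) * (starRingEnd ℂ) (f₀ x) = 0 := by
    have := sub_eq_zero.2 hΦb
    rw [← this]; ring
  have h3 : (starRingEnd ℂ) (f₀ x) = 0 := by
    rcases mul_eq_zero.1 h2 with h | h
    · exact absurd h (mul_ne_zero two_ne_zero Complex.I_ne_zero)
    · exact h
  show star (f₀ x) = (0 : (adelicGroupData F E c 2 J).Adelic → ℂ) x
  rw [Pi.zero_apply, Complex.star_def, h3]

/-- Right translation by `g ∈ U(J)(𝔸_{F,f})` preserves the `(0,1)` forms `conj (holCotForms₂ 𝔣)` (M2: `rightRep₂_mem_holCotForms₂`,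
`conjFun₂_rightRep₂`). [cite: BorelJacquet1979, §4.2] [cite: BorelWallach2000, VII 2.10] -/
theorem rightRep₂_mem_map_conjFun₂ (𝔣 : ConeFrame E J w₁) (g : finAdelic F E c 2 J) {f : (adelicGroupData F E c 2 J).Adelic → ℂ}
    (hf : f ∈ (holCotForms₂ F E c J hc hfix w₁ 𝔣).map (conjFun₂ F E c J)) :
    rightRep₂ F E c J g f ∈ (holCotForms₂ F E c J hc hfix w₁ 𝔣).map (conjFun₂ F E c J) := by
  obtain ⟨f₀, hf₀, rfl⟩ := Submodule.mem_map.1 hf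
  exact Submodule.mem_map.2 ⟨_, rightRep₂_mem_holCotForms₂ F E c J hc hfix w₁ 𝔣 g hf₀, conjFun₂_rightRep₂ F E c J g f₀⟩

/-- **The two Hodge types are disjoint and Hecke-stable** — the `n = 2` twin of P3's `StubS2HodgeTypesDisjointStable`, packaged in the shape of
hypothesis `hS2` of the slice's assembly lemma (`Disjoint A B ∧ (∀ g x, x ∈ A → R g x ∈ A) ∧ (∀ g x, x ∈ B → R g x ∈ B)` at `A = holCotForms₂ 𝔣`,
`B = conj A`, `R = rightRep₂`). [cite: Borel1997, §5.14] [cite: BorelJacquet1979, §4.2] [cite: BorelWallach2000, VII 2.10 and 3.6] -/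
theorem hodgeTypes₂_disjoint_stable (hJ : (J.map w₁.1.embedding).IsHermitian) (𝔣 : ConeFrame E J w₁) :
    Disjoint (holCotForms₂ F E c J hc hfix w₁ 𝔣) ((holCotForms₂ F E c J hc hfix w₁ 𝔣).map (conjFun₂ F E c J)) ∧
      (∀ (g : finAdelic F E c 2 J) (f : (adelicGroupData F E c 2 J).Adelic → ℂ),
          f ∈ holCotForms₂ F E c J hc hfix w₁ 𝔣 → rightRep₂ F E c J g f ∈ holCotForms₂ F E c J hc hfix w₁ 𝔣) ∧
      (∀ (g : finAdelic F E c 2 J) (f : (adelicGroupData F E c 2 J).Adelic → ℂ),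
          f ∈ (holCotForms₂ F E c J hc hfix w₁ 𝔣).map (conjFun₂ F E c J) →
            rightRep₂ F E c J g f ∈ (holCotForms₂ F E c J hc hfix w₁ 𝔣).map (conjFun₂ F E c J)) :=
  ⟨disjoint_holCotForms₂_map_conjFun₂ F E c J hc hfix w₁ hJ 𝔣, fun g _ hf => rightRep₂_mem_holCotForms₂ F E c J hc hfix w₁ 𝔣 g hf,
    fun g _ hf => rightRep₂_mem_map_conjFun₂ F E c J hc hfix w₁ 𝔣 g hf⟩

end Carriers


/-! ## §3 `σ_{w₁}J⋆` is hermitian for the record's `J⋆` (read off the rational frame `hg`), and (D) at the binders of the slice -/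

section Hermitian

open NumberField.IsCMField

variable (L : Type) [Field L] [NumberField L] [IsCMField L]

/-- **`σ(J⋆)` is a hermitian matrix** for every complex embedding `σ` of the CM field `L`, when `t • J⋆` is `c`-congruent over `L` to a real
diagonal matrix (`ᵗ(c g⋆) (t • J⋆) g⋆ = diag dJ`, `c (dJ i) = dJ i`) with `t ≠ 0` real at SOME embedding `ι₁` (hence `c t = t`):
`t • J⋆ = ᵗ(c g⋆⁻¹) (diag dJ) g⋆⁻¹` is `c`-hermitian (`c (M j i) = M i j`), so is `J⋆`, and `σ ∘ c = conj ∘ σ` (Mathlib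
`IsCMField.complexEmbedding_complexConj`). [folklore] -/
theorem isHermitian_map_of_formCongr (ι₁ : L →+* ℂ) (Jstar : Matrix (Fin 2) (Fin 2) L) (t : L) (ht : t ≠ 0) (hτt' : (ι₁ t).im = 0)
    (gstar : GL (Fin 2) L) (dJ : Fin 2 → L) (hdJ : ∀ i, IsCMField.complexConj L (dJ i) = dJ i)
    (hg : formCongr ((IsCMField.complexConj L : L ≃ₐ[↥(maximalRealSubfield L)] L) : L →+* L) gstar (t • Jstar) = Matrix.diagonal dJ)
    (σ : L →+* ℂ) : (Jstar.map σ).IsHermitian := by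
  -- notation
  set c : L →+* L := ((IsCMField.complexConj L : L ≃ₐ[↥(maximalRealSubfield L)] L) : L →+* L) with hcdef
  have hc_apply : ∀ x : L, c x = IsCMField.complexConj L x := fun x => rfl
  have hcc : ∀ x : L, c (c x) = x := fun x => by rw [hc_apply, hc_apply, complexConj_apply_apply]
  -- `c t = t` (the embedding `ι₁` sees `t` as a real number)
  have hct : c t = t := by
    apply ι₁.injective
    rw [hc_apply, complexEmbedding_complexConj, Complex.conj_eq_iff_im.2 hτt']
  -- `t • J⋆ = formCongr c g⋆⁻¹ (diag dJ)`
  have hM : t • Jstar = formCongr c gstar⁻¹ (Matrix.diagonal dJ) := by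
    rw [← hg, formCongr_inv_formCongr]
  -- `c`-hermitian symmetry of `t • J⋆`: `((t • J⋆)ᵀ).map c = t • J⋆`
  have hP : (((gstar⁻¹ : GL (Fin 2) L) : Matrix (Fin 2) (Fin 2) L).map c).map c = ((gstar⁻¹ : GL (Fin 2) L) : Matrix (Fin 2) (Fin 2) L) := by
    ext i j
    simp only [Matrix.map_apply, hcc]
  have hD : ((Matrix.diagonal dJ)ᵀ).map c = Matrix.diagonal dJ := by
    rw [Matrix.diagonal_transpose, Matrix.diagonal_map (map_zero c)]
    congr 1
    funext i
    exact hdJ i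
  have hMt : ((t • Jstar)ᵀ).map c = t • Jstar := by
    rw [hM]
    simp only [formCongr, Matrix.transpose_mul, Matrix.transpose_transpose, Matrix.map_mul, hD, Matrix.transpose_map, hP,
      Matrix.mul_assoc]
  -- entrywise: `c (J⋆ j i) = J⋆ i j`
  have hcJ : ∀ i j, c (Jstar j i) = Jstar i j := by
    intro i j
    have h := congrFun (congrFun hMt i) j
    simp only [Matrix.map_apply, Matrix.transpose_apply, Matrix.smul_apply, smul_eq_mul, map_mul, hct] at h
    exact mul_left_cancel₀ ht h
  -- hermitian over `ℂ`
  refine Matrix.ext fun i j => ?_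
  rw [Matrix.conjTranspose_apply, Matrix.map_apply, Matrix.map_apply, ← hcJ i j, hc_apply, complexEmbedding_complexConj,
    Complex.star_def]

end Hermitian

end Summit.HodgeConjecture.HodgeConjecture.Cruxes.HLiu418.CurveHodgeTypesDisjoint

end
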